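import Mathlib
import HarnessLib
import Literature.Probability.MarkovChains.ConvergenceTheorem
import Literature.Probability.MarkovChains.CountingBound
import Literature.Probability.MarkovChains.DiameterBound
import Literature.Probability.MarkovChains.OptimalCoupling

/-!
# Separation distance: `d(t) ≤ s(t)` and `s(2t) ≤ 1 − (1 − d̄(t))²` for reversible chains (Levin–Peres–Wilmer §6.4)

HONEST FRAMING: exact (Metropolis-corrected) sampling algorithms for lattice gauge theory; figures
of merit are autocorrelation/cost numbers at stated couplings and volumes; no continuum-physics claim.

Conventions of `TotalVariation.lean` (`tvDist`, `lawAt`, `IsRowStochastic`), `MetropolisHastings.lean`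
(`IsStationary`, `DetailedBalance`), `MixingTimeSubmultiplicative.lean` / `BottleneckRatio.lean`
(`kernelAt P t x y = Pᵗ(x,y)`, `worstTvDist P π t = d(t)`, `worstPairTvDist P t = d̄(t)`),
`OptimalCoupling.lean` (eq. (4.13)) and `ConvergenceTheorem.lean` (Thm 4.9).  Source: D. A. Levin,
Y. Peres (with E. L. Wilmer), *Markov Chains and Mixing Times*, 2nd ed., AMS 2017 [LevinPeres2017],
§6.4 "Strong stationary times and bounding distance", pp. 79–81: eqs. (6.6)–(6.7), Exercise 6.4,
Lemma 6.16, Lemma 6.17.  Everything is PROVED (finite sums; 0 named facts).  NOT here: strong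
stationary times themselves (Prop. 6.11, Lemma 6.12, Prop. 6.14), which need the trajectory space.

* `sepDistFrom P π x t` — **eq. (6.6)** `s_x(t) = max_y [1 − Pᵗ(x,y)/π(y)]` and `sepDist P π t` —
  **eq. (6.7)** `s(t) = max_x s_x(t)` [cite: LevinPeres2017, §6.4 eqs. (6.6)–(6.7)] (as `⨆` over the
  finite state space); `sepDistFrom_nonneg`, `sepDist_le_one`-type bounds;
* `sepDistFrom_succ_le`, `sepDistFrom_antitone` — **`s_x(t)` is weakly decreasing in `t`**
  (`1 − P^{t+1}(x,y)/π(y)` is a `π(z)P(z,y)/π(y)`-average of the `1 − Pᵗ(x,z)/π(z)`)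
  [cite: LevinPeres2017, §6.4 ("The distance `s_x(t)` is weakly decreasing in `t`"), Exercise 6.4];
* **LEMMA 6.16** `LevinPeres2017_lemma_6_16` — **`‖Pᵗ(x,·) − π‖_TV ≤ s_x(t)`**, and therefore
  `d(t) ≤ s(t)` (`LevinPeres2017_lemma_6_16_worst`) [cite: LevinPeres2017, §6.4 Lemma 6.16 eq. (6.11)];
* `DetailedBalance.pow_apply` — `π(x)Pᵗ(x,y) = π(y)Pᵗ(y,x)` for a reversible chain
  [cite: LevinPeres2017, §1.6 eq. (1.30) (summed over the intermediate states)];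
* **LEMMA 6.17** `LevinPeres2017_lemma_6_17` — for a reversible chain
  **`s(2t) ≤ 1 − (1 − d̄(t))² ≤ 2d̄(t) ≤ 4d(t)`**; the pointwise core
  `LevinPeres2017_lemma_6_17_pointwise`: `1 − P^{2t}(x,y)/π(y) ≤ 1 − (1 − ‖Pᵗ(x,·) − Pᵗ(y,·)‖_TV)²`
  by reversibility, Cauchy–Schwarz and eq. (4.13) [cite: LevinPeres2017, §6.4 Lemma 6.17 eq. (6.12)];
* `sepDist_le_div` — `s(t) ≤ 2d(t)/π_min`, whence **`s(t) → 0`** for an irreducible aperiodic chain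
  (`sepDist_tendsto_zero`, via Theorem 4.9 of `ConvergenceTheorem.lean`) [cite: LevinPeres2017, §6.4
  ("The Convergence Theorem implies that `s(t) → 0` as `t → ∞` for aperiodic irreducible chains")].

Context (cell pub-lqcd, venture LatticeQCDFlow): separation bounds are what strong-stationary-time /
coupling-from-the-past style exactness certificates deliver; Lemma 6.16 converts them into the
cell's figure of merit `d(t)`, Lemma 6.17 says that for REVERSIBLE (Metropolis-corrected) samplers
nothing is lost beyond a factor `4` and a doubling of time.
-/

namespace Literature.Probability.MarkovChains

open Finset Matrix

variable {X : Type*} [Fintype X] [DecidableEq X]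

/-! ## The separation distance (6.6)–(6.7) -/

/-- **Eq. (6.6)**: the separation distance from `x` at time `t`, `s_x(t) = max_y [1 − Pᵗ(x,y)/π(y)]`
(as `⨆` over the finite `X`; `0` on an empty `X`). [cite: LevinPeres2017, §6.4 eq. (6.6)] -/
noncomputable def sepDistFrom (P : X → X → ℝ) (π : X → ℝ) (x : X) (t : ℕ) : ℝ :=
  ⨆ y : X, (1 - kernelAt P t x y / π y)

/-- **Eq. (6.7)**: `s(t) = max_x s_x(t)`. [cite: LevinPeres2017, §6.4 eq. (6.7)] -/
noncomputable def sepDist (P : X → X → ℝ) (π : X → ℝ) (t : ℕ) : ℝ :=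
  ⨆ x : X, sepDistFrom P π x t

variable {P : Matrix X X ℝ} {π : X → ℝ}

/-- `1 − Pᵗ(x,y)/π(y) ≤ s_x(t)`. [cite: LevinPeres2017, §6.4 eq. (6.6)] -/
theorem le_sepDistFrom (P : X → X → ℝ) (π : X → ℝ) (x : X) (t : ℕ) (y : X) :
    1 - kernelAt P t x y / π y ≤ sepDistFrom P π x t :=
  le_ciSup (f := fun y => 1 - kernelAt P t x y / π y) (Set.finite_range _).bddAbove y

/-- `s_x(t) ≤ s(t)`. [cite: LevinPeres2017, §6.4 eq. (6.7)] -/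
theorem sepDistFrom_le_sepDist (P : X → X → ℝ) (π : X → ℝ) (x : X) (t : ℕ) :
    sepDistFrom P π x t ≤ sepDist P π t :=
  le_ciSup (f := fun x => sepDistFrom P π x t) (Set.finite_range _).bddAbove x

/-- `s_x(t) ≤ 1` for `Pᵗ ≥ 0`, `π ≥ 0` (every term `1 − Pᵗ(x,y)/π(y)` is at most `1`).
[cite: LevinPeres2017, §6.4 eq. (6.6)] -/
theorem sepDistFrom_le_one (hP : IsRowStochastic P) (hπ0 : ∀ y, 0 ≤ π y) (x : X) (t : ℕ) :
    sepDistFrom P π x t ≤ 1 := by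
  refine Real.iSup_le (fun y => ?_) zero_le_one
  have : 0 ≤ kernelAt P t x y / π y :=
    div_nonneg ((kernelAt_isRowStochastic hP t).1 x y) (hπ0 y)
  linarith

/-- `s(t) ≤ 1`. [cite: LevinPeres2017, §6.4 eq. (6.7)] -/
theorem sepDist_le_one (hP : IsRowStochastic P) (hπ0 : ∀ y, 0 ≤ π y) (t : ℕ) :
    sepDist P π t ≤ 1 :=
  Real.iSup_le (fun x => sepDistFrom_le_one hP hπ0 x t) zero_le_one

/-- `s_x(t) ≥ 0`: since `Σ_y Pᵗ(x,y) = 1 = Σ_y π(y)`, some `y` has `Pᵗ(x,y) ≤ π(y)`.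
[cite: LevinPeres2017, §6.4 eq. (6.6)] -/
theorem sepDistFrom_nonneg (hP : IsRowStochastic P) (hπ0 : ∀ y, 0 ≤ π y) (hπ1 : ∑ y, π y = 1)
    (x : X) (t : ℕ) : 0 ≤ sepDistFrom P π x t := by
  have hne : (univ : Finset X).Nonempty := ⟨x, mem_univ x⟩
  obtain ⟨y, -, hy⟩ := exists_le_of_sum_le hne
    (f := fun y => kernelAt P t x y) (g := π) (by rw [sum_kernelAt hP t x, hπ1])
  refine le_trans ?_ (le_sepDistFrom P π x t y)
  rcases (hπ0 y).lt_or_eq with hpos | h0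
  · rw [sub_nonneg, div_le_one hpos]
    exact hy
  · rw [← h0, div_zero, sub_zero]
    exact zero_le_one

/-- `s(t) ≥ 0` (nonempty `X`). [cite: LevinPeres2017, §6.4 eq. (6.7)] -/
theorem sepDist_nonneg [Nonempty X] (hP : IsRowStochastic P) (hπ0 : ∀ y, 0 ≤ π y)
    (hπ1 : ∑ y, π y = 1) (t : ℕ) : 0 ≤ sepDist P π t :=
  (sepDistFrom_nonneg hP hπ0 hπ1 (Classical.arbitrary X) t).trans
    (sepDistFrom_le_sepDist P π _ t)

/-! ## Exercise 6.4: `s_x(t)` is weakly decreasing -/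

/-- **`s_x(t+1) ≤ s_x(t)`** for a positive stationary `π`: by stationarity
`1 − P^{t+1}(x,y)/π(y) = Σ_z [π(z)P(z,y)/π(y)]·[1 − Pᵗ(x,z)/π(z)]`, an average with weights summing to
one. [cite: LevinPeres2017, §6.4 ("The distance `s_x(t)` is weakly decreasing in `t`"), Exercise 6.4] -/
theorem sepDistFrom_succ_le (hP : IsRowStochastic P) (hπ : IsStationary π P) (hπpos : ∀ y, 0 < π y)
    (x : X) (t : ℕ) : sepDistFrom P π x (t + 1) ≤ sepDistFrom P π x t := by
  haveI : Nonempty X := ⟨x⟩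
  refine ciSup_le fun y => ?_
  have hy : π y ≠ 0 := (hπpos y).ne'
  have hw1 : ∑ z, π z * P z y / π y = 1 := by
    rw [← sum_div, hπ y, div_self hy]
  have hexp : 1 - kernelAt P (t + 1) x y / π y =
      ∑ z, (π z * P z y / π y) * (1 - kernelAt P t x z / π z) := by
    simp_rw [mul_sub, mul_one]
    rw [sum_sub_distrib, hw1, kernelAt_succ_apply, sum_div]
    congr 1
    refine sum_congr rfl fun z _ => ?_
    have hz : π z ≠ 0 := (hπpos z).ne'
    field_simp
  rw [hexp]
  calc ∑ z, (π z * P z y / π y) * (1 - kernelAt P t x z / π z)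
      ≤ ∑ z, (π z * P z y / π y) * sepDistFrom P π x t :=
        sum_le_sum fun z _ => mul_le_mul_of_nonneg_left (le_sepDistFrom P π x t z)
          (div_nonneg (mul_nonneg (hπpos z).le (hP.1 z y)) (hπpos y).le)
    _ = sepDistFrom P π x t := by rw [← sum_mul, hw1, one_mul]

/-- `t ↦ s_x(t)` is antitone (positive stationary `π`). [cite: LevinPeres2017, Exercise 6.4] -/
theorem sepDistFrom_antitone (hP : IsRowStochastic P) (hπ : IsStationary π P) (hπpos : ∀ y, 0 < π y)
    (x : X) : Antitone (fun t => sepDistFrom P π x t) :=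
  antitone_nat_of_succ_le fun t => sepDistFrom_succ_le hP hπ hπpos x t

/-- `t ↦ s(t)` is antitone (positive stationary `π`). [cite: LevinPeres2017, Exercise 6.4 with §6.4
eq. (6.7)] -/
theorem sepDist_antitone (hP : IsRowStochastic P) (hπ : IsStationary π P) (hπpos : ∀ y, 0 < π y) :
    Antitone (sepDist P π) :=
  antitone_nat_of_succ_le fun t =>
    ciSup_mono (Set.finite_range _).bddAbove fun x => sepDistFrom_succ_le hP hπ hπpos x t

/-! ## Lemma 6.16: `d(t) ≤ s(t)` -/

/-- **LEMMA 6.16**: **`‖Pᵗ(x,·) − π‖_TV ≤ s_x(t)`** — as printed,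
`‖Pᵗ(x,·) − π‖_TV = Σ_{y : Pᵗ(x,y) < π(y)} π(y)[1 − Pᵗ(x,y)/π(y)] ≤ s_x(t)` (`π` a probability
vector). [cite: LevinPeres2017, §6.4 Lemma 6.16 eq. (6.11)] -/
theorem LevinPeres2017_lemma_6_16 (hP : IsRowStochastic P) (hπ0 : ∀ y, 0 ≤ π y)
    (hπ1 : ∑ y, π y = 1) (x : X) (t : ℕ) :
    tvDist (lawAt P (Pi.single x 1) t) π ≤ sepDistFrom P π x t := by
  show tvDist (kernelAt P t x) π ≤ sepDistFrom P π x t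
  have hμ1 : ∑ y, kernelAt P t x y = 1 := sum_kernelAt hP t x
  have hμ0 : ∀ y, 0 ≤ kernelAt P t x y := (kernelAt_isRowStochastic hP t).1 x
  have hs := sepDistFrom_nonneg hP hπ0 hπ1 x t
  rw [tvDist_comm, tvDist_eq_sum_filter (by rw [hπ1, hμ1])]
  calc ∑ y ∈ univ.filter (fun y => kernelAt P t x y ≤ π y), (π y - kernelAt P t x y)
      ≤ ∑ y ∈ univ.filter (fun y => kernelAt P t x y ≤ π y), π y * sepDistFrom P π x t := by
        refine sum_le_sum fun y _ => ?_
        rcases (hπ0 y).lt_or_eq with hpos | h0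
        · have h1 : π y - kernelAt P t x y = π y * (1 - kernelAt P t x y / π y) := by
            field_simp
          rw [h1]
          exact mul_le_mul_of_nonneg_left (le_sepDistFrom P π x t y) hpos.le
        · rw [← h0, zero_mul, zero_sub, neg_nonpos]
          exact hμ0 y
    _ = (∑ y ∈ univ.filter (fun y => kernelAt P t x y ≤ π y), π y) * sepDistFrom P π x t := by
        rw [sum_mul]
    _ ≤ 1 * sepDistFrom P π x t :=
        mul_le_mul_of_nonneg_right ((sum_le_univ_sum_of_nonneg hπ0).trans_eq hπ1) hs
    _ = sepDistFrom P π x t := one_mul _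

/-- **Lemma 6.16, "and therefore `d(t) ≤ s(t)`"**. [cite: LevinPeres2017, §6.4 Lemma 6.16] -/
theorem LevinPeres2017_lemma_6_16_worst (hP : IsRowStochastic P) (hπ0 : ∀ y, 0 ≤ π y)
    (hπ1 : ∑ y, π y = 1) (t : ℕ) : worstTvDist P π t ≤ sepDist P π t := by
  rcases isEmpty_or_nonempty X with hX | hX
  · simp [worstTvDist, sepDist]
  · exact ciSup_mono (Set.finite_range _).bddAbove fun x => LevinPeres2017_lemma_6_16 hP hπ0 hπ1 x t

/-! ## Lemma 6.17: reversible chains -/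

/-- **Reversibility of the powers**: `π(x)Pᵗ(x,y) = π(y)Pᵗ(y,x)` for a `π` in detailed balance with
`P`. [cite: LevinPeres2017, §1.6 eq. (1.30) (the path identity, summed over the intermediate
states)] -/
theorem DetailedBalance.pow_apply (hDB : DetailedBalance π P) :
    ∀ (t : ℕ) (x y : X), π x * (P ^ t) x y = π y * (P ^ t) y x := by
  intro t
  induction t with
  | zero =>
    intro x y
    by_cases h : x = y
    · subst h
      rfl
    · rw [pow_zero, one_apply_ne h, one_apply_ne (Ne.symm h), mul_zero, mul_zero]
  | succ t ih =>
    intro x y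
    conv_lhs => rw [pow_succ, mul_apply, mul_sum]
    conv_rhs => rw [pow_succ', mul_apply, mul_sum]
    refine sum_congr rfl fun z _ => ?_
    calc π x * ((P ^ t) x z * P z y) = (π x * (P ^ t) x z) * P z y := by ring
      _ = (π z * (P ^ t) z x) * P z y := by rw [ih x z]
      _ = (P ^ t) z x * (π z * P z y) := by ring
      _ = (P ^ t) z x * (π y * P y z) := by rw [hDB z y]
      _ = π y * (P y z * (P ^ t) z x) := by ring

/-- `π(x)Pᵗ(x,y) = π(y)Pᵗ(y,x)` in the `kernelAt` notation. [cite: LevinPeres2017, §1.6 eq. (1.30)] -/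
theorem DetailedBalance.kernelAt (hDB : DetailedBalance π P) (t : ℕ) (x y : X) :
    π x * kernelAt P t x y = π y * kernelAt P t y x := by
  rw [kernelAt_eq_pow_apply, kernelAt_eq_pow_apply]
  exact hDB.pow_apply t x y

/-- **Lemma 6.17, the pointwise core**: for a reversible chain with positive `π`,
`P^{2t}(x,y)/π(y) = Σ_z Pᵗ(x,z)Pᵗ(y,z)/π(z) ≥ (Σ_z √(Pᵗ(x,z)Pᵗ(y,z)))² ≥ (Σ_z Pᵗ(x,z) ∧ Pᵗ(y,z))²
= (1 − ‖Pᵗ(x,·) − Pᵗ(y,·)‖_TV)²` (reversibility, Cauchy–Schwarz, eq. (4.13)), i.e.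
`1 − P^{2t}(x,y)/π(y) ≤ 1 − (1 − ‖Pᵗ(x,·) − Pᵗ(y,·)‖_TV)²`.
[cite: LevinPeres2017, §6.4 Lemma 6.17 (proof)] -/
theorem LevinPeres2017_lemma_6_17_pointwise (hP : IsRowStochastic P) (hDB : DetailedBalance π P)
    (hπpos : ∀ y, 0 < π y) (hπ1 : ∑ y, π y = 1) (x y : X) (t : ℕ) :
    1 - kernelAt P (2 * t) x y / π y ≤
      1 - (1 - tvDist (kernelAt P t x) (kernelAt P t y)) ^ 2 := by
  have ha0 : ∀ z, 0 ≤ kernelAt P t x z := (kernelAt_isRowStochastic hP t).1 x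
  have hb0 : ∀ z, 0 ≤ kernelAt P t y z := (kernelAt_isRowStochastic hP t).1 y
  have ha1 : ∑ z, kernelAt P t x z = 1 := sum_kernelAt hP t x
  have hb1 : ∑ z, kernelAt P t y z = 1 := sum_kernelAt hP t y
  -- (1) `P^{2t}(x,y)/π(y) = Σ_z Pᵗ(x,z)Pᵗ(y,z)/π(z)` by reversibility
  have h1 : kernelAt P (2 * t) x y / π y = ∑ z, kernelAt P t x z * kernelAt P t y z / π z := by
    have h2t : kernelAt P (2 * t) x y = ∑ z, kernelAt P t x z * kernelAt P t z y := by
      rw [two_mul, kernelAt_eq_pow_apply, pow_add, mul_apply]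
      simp_rw [← kernelAt_eq_pow_apply]
    rw [h2t, sum_div]
    refine sum_congr rfl fun z _ => ?_
    have hdb := hDB.kernelAt t z y
    have hz : π z ≠ 0 := (hπpos z).ne'
    have hy : π y ≠ 0 := (hπpos y).ne'
    field_simp
    linear_combination kernelAt P t x z * hdb
  -- (2) Cauchy–Schwarz: `(Σ_z √(ab))² ≤ Σ_z ab/π`
  have h2 : (∑ z, Real.sqrt (kernelAt P t x z * kernelAt P t y z)) ^ 2 ≤
      ∑ z, kernelAt P t x z * kernelAt P t y z / π z := by
    have hcs := sum_mul_sq_le_sq_mul_sq univ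
      (fun z => Real.sqrt (kernelAt P t x z * kernelAt P t y z / π z)) (fun z => Real.sqrt (π z))
    have hfg : ∀ z, Real.sqrt (kernelAt P t x z * kernelAt P t y z / π z) * Real.sqrt (π z) =
        Real.sqrt (kernelAt P t x z * kernelAt P t y z) := fun z => by
      rw [← Real.sqrt_mul (div_nonneg (mul_nonneg (ha0 z) (hb0 z)) (hπpos z).le),
        div_mul_cancel₀ _ (hπpos z).ne']
    have hf2 : ∀ z, Real.sqrt (kernelAt P t x z * kernelAt P t y z / π z) ^ 2 =
        kernelAt P t x z * kernelAt P t y z / π z := fun z =>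
      Real.sq_sqrt (div_nonneg (mul_nonneg (ha0 z) (hb0 z)) (hπpos z).le)
    have hg2 : ∀ z, Real.sqrt (π z) ^ 2 = π z := fun z => Real.sq_sqrt (hπpos z).le
    simp_rw [hfg, hf2, hg2] at hcs
    rw [hπ1, mul_one] at hcs
    exact hcs
  -- (3) `a ∧ b ≤ √(ab)`
  have h3 : ∑ z, min (kernelAt P t x z) (kernelAt P t y z) ≤
      ∑ z, Real.sqrt (kernelAt P t x z * kernelAt P t y z) := sum_le_sum fun z _ => by
    have hmin : min (kernelAt P t x z) (kernelAt P t y z) ^ 2 ≤ kernelAt P t x z * kernelAt P t y z := by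
      rcases le_total (kernelAt P t x z) (kernelAt P t y z) with h | h
      · rw [min_eq_left h, sq]
        exact mul_le_mul_of_nonneg_left h (ha0 z)
      · rw [min_eq_right h, sq]
        exact mul_le_mul_of_nonneg_right h (hb0 z)
    rw [← Real.sqrt_sq (le_min (ha0 z) (hb0 z))]
    exact Real.sqrt_le_sqrt hmin
  -- (4) eq. (4.13): `Σ_z a ∧ b = 1 − ‖a − b‖_TV`
  have h4 := sum_min_eq_one_sub_tvDist ha1 hb1
  have hmin0 : 0 ≤ ∑ z, min (kernelAt P t x z) (kernelAt P t y z) :=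
    sum_nonneg fun z _ => le_min (ha0 z) (hb0 z)
  have h5 : (1 - tvDist (kernelAt P t x) (kernelAt P t y)) ^ 2 ≤ kernelAt P (2 * t) x y / π y := by
    rw [h1, ← h4]
    exact (pow_le_pow_left₀ hmin0 h3 2).trans h2
  linarith

/-- **LEMMA 6.17**: for a reversible chain (positive `π` in detailed balance with `P`), the separation
and total variation distances satisfy **`s(2t) ≤ 1 − (1 − d̄(t))² ≤ 2d̄(t) ≤ 4d(t)`**.
[cite: LevinPeres2017, §6.4 Lemma 6.17 eq. (6.12)] -/
theorem LevinPeres2017_lemma_6_17 (hP : IsRowStochastic P) (hDB : DetailedBalance π P)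
    (hπpos : ∀ y, 0 < π y) (hπ1 : ∑ y, π y = 1) (t : ℕ) :
    sepDist P π (2 * t) ≤ 1 - (1 - worstPairTvDist P t) ^ 2 ∧
      1 - (1 - worstPairTvDist P t) ^ 2 ≤ 2 * worstPairTvDist P t ∧
      2 * worstPairTvDist P t ≤ 4 * worstTvDist P π t := by
  have hd0 := worstPairTvDist_nonneg P t
  have hd1 := worstPairTvDist_le_one hP t
  have hb0 : 0 ≤ 1 - (1 - worstPairTvDist P t) ^ 2 := by nlinarith
  refine ⟨?_, by nlinarith, by linarith [worstPairTvDist_le_two_mul P π t]⟩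
  refine Real.iSup_le (fun x => Real.iSup_le (fun y => ?_) hb0) hb0
  have htv : tvDist (kernelAt P t x) (kernelAt P t y) ≤ worstPairTvDist P t :=
    tvDist_pair_le_worstPairTvDist P t x y
  have hsq : (1 - worstPairTvDist P t) ^ 2 ≤ (1 - tvDist (kernelAt P t x) (kernelAt P t y)) ^ 2 :=
    pow_le_pow_left₀ (sub_nonneg.2 hd1) (by linarith) 2
  linarith [LevinPeres2017_lemma_6_17_pointwise hP hDB hπpos hπ1 x y t]

/-! ## `s(t) → 0` -/

/-- `s(t) ≤ 2d(t)/m` whenever `π ≥ m > 0` pointwise (`π(y) − Pᵗ(x,y) ≤ 2‖Pᵗ(x,·) − π‖_TV`).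
[cite: LevinPeres2017, §6.4 ("The Convergence Theorem implies that `s(t) → 0`"), with §4.1
Prop. 4.2] -/
theorem sepDist_le_div (P : Matrix X X ℝ) {m : ℝ} (hm0 : 0 < m) (hm : ∀ y, m ≤ π y)
    (t : ℕ) : sepDist P π t ≤ 2 * worstTvDist P π t / m := by
  have hd0 := worstTvDist_nonneg P π t
  refine Real.iSup_le (fun x => Real.iSup_le (fun y => ?_) (by positivity)) (by positivity)
  have hπy : 0 < π y := hm0.trans_le (hm y)
  have habs : |kernelAt P t x y - π y| ≤ ∑ z, |kernelAt P t x z - π z| :=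
    single_le_sum (f := fun z => |kernelAt P t x z - π z|) (fun z _ => abs_nonneg _) (mem_univ y)
  have htv : tvDist (kernelAt P t x) π ≤ worstTvDist P π t := tvDist_single_le_worstTvDist P π t x
  have hdiff : π y - kernelAt P t x y ≤ 2 * worstTvDist P π t := by
    unfold tvDist at htv
    have := neg_abs_le (kernelAt P t x y - π y)
    linarith
  have hrew : 1 - kernelAt P t x y / π y = (π y - kernelAt P t x y) / π y := by
    field_simp
  rw [hrew]
  exact (div_le_div_of_nonneg_right hdiff hπy.le).trans
    (div_le_div_of_nonneg_left (by positivity) hm0 (hm y))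

/-- **`s(t) → 0` as `t → ∞` for an irreducible aperiodic chain** (positive stationary `π`), from the
Convergence Theorem. [cite: LevinPeres2017, §6.4 ("The Convergence Theorem implies that `s(t) → 0` as
`t → ∞` for aperiodic irreducible chains")] -/
theorem sepDist_tendsto_zero (hP : IsRowStochastic P) (hirr : IsIrreducible P) (hap : IsAperiodic P)
    (hπ : IsStationary π P) (hπpos : ∀ y, 0 < π y) (hπ1 : ∑ y, π y = 1) :
    Filter.Tendsto (sepDist P π) Filter.atTop (nhds 0) := by
  obtain ⟨x₁, -, -⟩ := Finset.exists_ne_zero_of_sum_ne_zero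
    (s := (univ : Finset X)) (f := π) (by rw [hπ1]; exact one_ne_zero)
  haveI : Nonempty X := ⟨x₁⟩
  obtain ⟨y₀, -, hy₀⟩ := exists_min_image (univ : Finset X) π univ_nonempty
  have hm : ∀ y, π y₀ ≤ π y := fun y => hy₀ y (mem_univ y)
  have hlim := LevinPeres2017_thm_4_9_tendsto hP hirr hap hπ (fun y => (hπpos y).le) hπ1
  have hlim2 : Filter.Tendsto (fun t => 2 * worstTvDist P π t / π y₀) Filter.atTop (nhds 0) := by
    simpa using (hlim.const_mul 2).div_const (π y₀)
  exact squeeze_zero (fun t => sepDist_nonneg hP (fun y => (hπpos y).le) hπ1 t)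
    (fun t => sepDist_le_div P (hπpos y₀) hm t) hlim2

end Literature.Probability.MarkovChains
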